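import Mathlib
import HarnessLib

/-!
# Strict positivity of exponential Gram kernels (abstract lemma)

Helper for the crux `FemtoCurvatureTwoPoint` (stmt-QuantumFields-9363, route `LangevinControlUV`),
registered sub-goal `stub_axisPositive` (strict positivity of the axis plaquette covariance).

On a finite measure space `(Ω, μ)` let `w` and `φᵢ` (`i` in a finite index set) be bounded
measurable REAL functions. The exponential Gram kernel `K(x, y) = exp(∑ᵢ φᵢ(x) φᵢ(y))` is of positive
type, and its quadratic form dominates every single Gram word:

  `(n!)⁻¹ · (∫ w · ∏ₜ φ_{wₜ} dμ)² ≤ ∫∫ w(x) w(y) exp(∑ᵢ φᵢ(x) φᵢ(y)) dμ(x) dμ(y)`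

(`sq_integral_word_le_integral_exp_gram`: expand the exponential, exchange sum and integral by
dominated convergence, `(∑ᵢ aᵢbᵢ)ⁿ = ∑_words ∏ₜ a_{wₜ} b_{wₜ}`, and every word contributes a square).
Hence if the quadratic form vanishes, `w` is orthogonal to every monomial in the `φᵢ`
(`integral_mul_prod_eq_zero_of_integral_exp_gram_eq_zero`) — the analytic half of the strict
positivity of the Wilson transfer matrix (the other half is Stone–Weierstrass).
Companion of the tree's `LatticeRP.integral_mul_mul_exp_sum_nonneg` (positivity only).
-/

set_option autoImplicit false

noncomputable section

open MeasureTheory Finset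

namespace Summit.QuantumFields.YangMills.Theorems.FemtoCurvatureTwoPoint.GramStrict

variable {Ω : Type*} [MeasurableSpace Ω] (μ : Measure Ω) [IsFiniteMeasure μ]
variable {I : Type*} [Fintype I]

/-- The `k`-th Taylor term of the exponential Gram form is `(k!)⁻¹ ∑_words (∫ w ∏ₜ φ_{wₜ})²`.
[folklore] -/
theorem integral_gram_term_eq (w : Ω → ℝ) (φ : I → Ω → ℝ) (hw : Measurable w)
    (hφ : ∀ i, Measurable (φ i)) {Kw Kφ : ℝ} (hwb : ∀ x, |w x| ≤ Kw) (hφb : ∀ i x, |φ i x| ≤ Kφ)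
    (k : ℕ) :
    ∫ p, w p.1 * w p.2 * ((∑ i, φ i p.1 * φ i p.2) ^ k / (k.factorial : ℝ)) ∂(μ.prod μ) =
      ((k.factorial : ℝ))⁻¹ *
        ∑ word : Fin k → I, (∫ x, w x * ∏ t, φ (word t) x ∂μ) ^ 2 := by
  classical
  have hexp : ∀ p : Ω × Ω, w p.1 * w p.2 * ((∑ i, φ i p.1 * φ i p.2) ^ k / (k.factorial : ℝ)) =
      ((k.factorial : ℝ))⁻¹ * ∑ word : Fin k → I,
        (w p.1 * ∏ t, φ (word t) p.1) * (w p.2 * ∏ t, φ (word t) p.2) := fun p => by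
    rw [Fintype.sum_pow]
    simp only [div_eq_mul_inv, Finset.mul_sum, Finset.sum_mul]
    refine Finset.sum_congr rfl fun word _ => ?_
    rw [Finset.prod_mul_distrib]
    ring
  simp_rw [hexp]
  rw [integral_const_mul]
  congr 1
  have hint : ∀ word : Fin k → I, Integrable (fun p : Ω × Ω =>
      (w p.1 * ∏ t, φ (word t) p.1) * (w p.2 * ∏ t, φ (word t) p.2)) (μ.prod μ) := by
    intro word
    have hm1 : Measurable fun x : Ω => w x * ∏ t, φ (word t) x :=
      hw.mul (Finset.measurable_prod _ fun t _ => hφ (word t))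
    refine Integrable.of_bound ((hm1.comp measurable_fst).mul (hm1.comp measurable_snd)).aestronglyMeasurable
      ((|Kw| * |Kφ| ^ k) * (|Kw| * |Kφ| ^ k)) (ae_of_all _ fun p => ?_)
    have hb : ∀ x : Ω, ‖w x * ∏ t, φ (word t) x‖ ≤ |Kw| * |Kφ| ^ k := fun x => by
      rw [norm_mul, norm_prod]
      refine mul_le_mul ((hwb x).trans (le_abs_self _)) ?_ (by positivity) (abs_nonneg _)
      calc ∏ t, ‖φ (word t) x‖ ≤ ∏ _t : Fin k, |Kφ| :=
            Finset.prod_le_prod (fun _ _ => norm_nonneg _) fun t _ =>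
              (hφb (word t) x).trans (le_abs_self _)
        _ = |Kφ| ^ k := by simp
    rw [norm_mul]
    exact mul_le_mul (hb p.1) (hb p.2) (norm_nonneg _) (by positivity)
  rw [integral_finsetSum _ fun word _ => hint word]
  refine Finset.sum_congr rfl fun word _ => ?_
  have hm1 : Measurable fun x : Ω => w x * ∏ t, φ (word t) x :=
    hw.mul (Finset.measurable_prod _ fun t _ => hφ (word t))
  rw [integral_prod_mul (μ := μ) (ν := μ) (fun x => w x * ∏ t, φ (word t) x)
    (fun y => w y * ∏ t, φ (word t) y), sq]

/-- **Every Gram word is dominated by the exponential Gram form.** For bounded measurable real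
`w, φᵢ` on a finite measure space and every word `word : Fin n → I`:
`(n!)⁻¹ (∫ w ∏ₜ φ_{word t})² ≤ ∫∫ w(x) w(y) exp(∑ᵢ φᵢ(x) φᵢ(y))`. [folklore] -/
theorem sq_integral_word_le_integral_exp_gram (w : Ω → ℝ) (φ : I → Ω → ℝ)
    (hw : Measurable w) (hφ : ∀ i, Measurable (φ i)) {Kw Kφ : ℝ} (hwb : ∀ x, |w x| ≤ Kw)
    (hφb : ∀ i x, |φ i x| ≤ Kφ) {n : ℕ} (word : Fin n → I) :
    ((n.factorial : ℝ))⁻¹ * (∫ x, w x * ∏ t, φ (word t) x ∂μ) ^ 2 ≤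
      ∫ p, w p.1 * w p.2 * Real.exp (∑ i, φ i p.1 * φ i p.2) ∂(μ.prod μ) := by
  classical
  set ν : Measure (Ω × Ω) := μ.prod μ with hν
  set s : Ω × Ω → ℝ := fun p => ∑ i, φ i p.1 * φ i p.2 with hs_def
  have hsm : Measurable s :=
    Finset.measurable_sum _ fun i _ => ((hφ i).comp measurable_fst).mul ((hφ i).comp measurable_snd)
  set B : ℝ := (Fintype.card I : ℝ) * (Kφ * Kφ) with hB_def
  have hsB : ∀ p, |s p| ≤ B := fun p => by
    calc |s p| ≤ ∑ i, |φ i p.1 * φ i p.2| := Finset.abs_sum_le_sum_abs _ _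
      _ ≤ ∑ _i : I, Kφ * Kφ := Finset.sum_le_sum fun i _ => by
          rw [abs_mul]
          exact mul_le_mul (hφb i p.1) (hφb i p.2) (abs_nonneg _)
            ((abs_nonneg _).trans (hφb i p.1))
      _ = B := by rw [Finset.sum_const, Finset.card_univ, nsmul_eq_mul]
  -- Taylor terms of the exponential
  set T : ℕ → Ω × Ω → ℝ := fun k p => w p.1 * w p.2 * (s p ^ k / (k.factorial : ℝ)) with hT_def
  have hwm2 : Measurable fun p : Ω × Ω => w p.1 * w p.2 :=
    (hw.comp measurable_fst).mul (hw.comp measurable_snd)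
  have hTm : ∀ k, Measurable (T k) := fun k => hwm2.mul ((hsm.pow_const k).div_const _)
  have hlim : ∀ p, HasSum (fun k => T k p) (w p.1 * w p.2 * Real.exp (s p)) := fun p => by
    have h := NormedSpace.expSeries_div_hasSum_exp (s p)
    rw [← congr_fun Real.exp_eq_exp_ℝ (s p)] at h
    exact h.mul_left (w p.1 * w p.2)
  set bound : ℕ → Ω × Ω → ℝ := fun k _ => Kw * Kw * (B ^ k / (k.factorial : ℝ)) with hbound_def
  have hTb : ∀ k p, ‖T k p‖ ≤ bound k p := fun k p => by
    simp only [hT_def, hbound_def, norm_mul, norm_div, norm_pow, Real.norm_eq_abs,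
      Nat.abs_cast]
    have h1 : |w p.1| * |w p.2| ≤ Kw * Kw :=
      mul_le_mul (hwb p.1) (hwb p.2) (abs_nonneg _) ((abs_nonneg _).trans (hwb p.1))
    have h2 : |s p| ^ k / (k.factorial : ℝ) ≤ B ^ k / (k.factorial : ℝ) :=
      div_le_div_of_nonneg_right (pow_le_pow_left₀ (abs_nonneg _) (hsB p) k) (Nat.cast_nonneg _)
    exact mul_le_mul h1 h2 (by positivity) (mul_nonneg ((abs_nonneg _).trans (hwb p.1))
      ((abs_nonneg _).trans (hwb p.1)))
  have hsum : HasSum (fun k => ∫ p, T k p ∂ν) (∫ p, w p.1 * w p.2 * Real.exp (s p) ∂ν) := by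
    refine hasSum_integral_of_dominated_convergence bound
      (fun k => (hTm k).aestronglyMeasurable) (fun k => ae_of_all _ (hTb k))
      (ae_of_all _ fun p => ?_) ?_ (ae_of_all _ hlim)
    · exact (Real.summable_pow_div_factorial B).mul_left (Kw * Kw)
    · show Integrable (fun _ => ∑' k : ℕ, Kw * Kw * (B ^ k / ((k.factorial : ℕ) : ℝ))) ν
      exact integrable_const _
  -- the terms are sums of squares
  have hTk : ∀ k, ∫ p, T k p ∂ν = ((k.factorial : ℝ))⁻¹ *
      ∑ word : Fin k → I, (∫ x, w x * ∏ t, φ (word t) x ∂μ) ^ 2 := fun k =>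
    integral_gram_term_eq μ w φ hw hφ hwb hφb k
  have hT0 : ∀ k, 0 ≤ ∫ p, T k p ∂ν := fun k => by
    rw [hTk]
    exact mul_nonneg (inv_nonneg.2 (Nat.cast_nonneg _)) (Finset.sum_nonneg fun _ _ => sq_nonneg _)
  have h1 : ∫ p, T n p ∂ν ≤ ∫ p, w p.1 * w p.2 * Real.exp (s p) ∂ν :=
    le_hasSum hsum n fun k _ => hT0 k
  refine le_trans ?_ h1
  rw [hTk]
  exact mul_le_mul_of_nonneg_left
    (Finset.single_le_sum (f := fun word : Fin n → I => (∫ x, w x * ∏ t, φ (word t) x ∂μ) ^ 2)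
      (fun _ _ => sq_nonneg _) (Finset.mem_univ word))
    (inv_nonneg.2 (Nat.cast_nonneg _))

/-- **Strict positivity of the exponential Gram kernel, word form.** If the quadratic form
`∫∫ w(x) w(y) exp(∑ᵢ φᵢ(x) φᵢ(y))` vanishes, then `w` is orthogonal to every monomial `∏ₜ φ_{word t}`
(in particular, with the empty word, `∫ w = 0`). [folklore] -/
theorem integral_mul_prod_eq_zero_of_integral_exp_gram_eq_zero (w : Ω → ℝ) (φ : I → Ω → ℝ)
    (hw : Measurable w) (hφ : ∀ i, Measurable (φ i)) {Kw Kφ : ℝ} (hwb : ∀ x, |w x| ≤ Kw)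
    (hφb : ∀ i x, |φ i x| ≤ Kφ)
    (h0 : ∫ p, w p.1 * w p.2 * Real.exp (∑ i, φ i p.1 * φ i p.2) ∂(μ.prod μ) = 0)
    {n : ℕ} (word : Fin n → I) :
    ∫ x, w x * ∏ t, φ (word t) x ∂μ = 0 := by
  have h := sq_integral_word_le_integral_exp_gram μ w φ hw hφ hwb hφb word
  rw [h0] at h
  have hfac : (0 : ℝ) < ((n.factorial : ℝ))⁻¹ := inv_pos.2 (Nat.cast_pos.2 (Nat.factorial_pos n))
  have hsq : (∫ x, w x * ∏ t, φ (word t) x ∂μ) ^ 2 ≤ 0 :=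
    le_of_mul_le_mul_left (h.trans_eq (mul_zero _).symm) hfac
  exact pow_eq_zero_iff (n := 2) (by norm_num) |>.1 (le_antisymm hsq (sq_nonneg _))

/-- **Registered sub-goal `stub_gramWordsVanish`** (`--supports stmt-QuantumFields-9363`): closed form of `integral_mul_prod_eq_zero_of_integral_exp_gram_eq_zero` — if the exponential Gram form of `w` vanishes, `w` is orthogonal to every Gram word. [folklore] -/
theorem stub_gramWordsVanish : ∀ (Ω : Type) [MeasurableSpace Ω] (μ : MeasureTheory.Measure Ω) [MeasureTheory.IsFiniteMeasure μ] (I : Type) [Fintype I] (w : Ω → ℝ) (φ : I → Ω → ℝ), Measurable w → (∀ i, Measurable (φ i)) → ∀ (Kw Kφ : ℝ), (∀ x, |w x| ≤ Kw) → (∀ i x, |φ i x| ≤ Kφ) → (∫ p, w p.1 * w p.2 * Real.exp (∑ i, φ i p.1 * φ i p.2) ∂(μ.prod μ)) = 0 → ∀ (n : ℕ) (word : Fin n → I), (∫ x, w x * ∏ t, φ (word t) x ∂μ) = 0 := by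
  intro Ω _ μ _ I _ w φ hw hφ Kw Kφ hwb hφb h0 n word
  exact integral_mul_prod_eq_zero_of_integral_exp_gram_eq_zero μ w φ hw hφ hwb hφb h0 word

end Summit.QuantumFields.YangMills.Theorems.FemtoCurvatureTwoPoint.GramStrict

end
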